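import Summits.BirchSwinnertonDyer.Rank1Residual.F1Sign2.KummerHalvingCriterion

/-!
# Cell `bsd-f1-sign2`, lens `-desc` g14 (MEMO-desc §22.13-add4): rows DESC-§22-H″ `Kummer.KummerMapHomomorphism` (the Kummer `4x − θ` map is a
# homomorphism modulo squares) and DESC-§22-H‴ `Kummer.KummerRankCertificate` (`c_W` irreducible, `κ(P) ∉ L² ⇒ P` of infinite order) — TYPED AND PROVED

TYPER FILING (seat `bsd-f1-sign2-ty` g8; CANDIDATES.md rows DESC-§22-H″/H‴; -desc ADDENDUM 7‴ 2026-08-28T10:23:32Z): part B of two (part A =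
`F1Sign2/KummerHalvingCriterion.lean`, row H′; the planner's import line named part A `…ParitySymbolCocycleAtTwoProofsKummer` — renamed here, nothing else
changed).  Source `HOME/MEMO-desc-data/g14/lean/KummerHomRank.lean` f07efacc10980db1 (218 l.; ns `…F1Sign2.Kummer` kept) lines 27–216 VERBATIM:
`isSquare_kummer_chord` (chord identity), `kummerElt` (`κ(0) = 1`, `κ(x,y) = 4x − θ_W`; def by pattern match), `kummerElt_zero/_some/_neg`,
`isSquare_kummerElt_mul_mul_add`, `halves_iff_isSquare_kummerElt`, row `KummerMapHomomorphism` + `_holds`, `not_equation_zero_of_irreducible`,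
`eq_zero_of_two(_pow)_nsmul_eq_zero_of_irreducible`, `exists_halves_of_isOfFinAddOrder`, `not_isOfFinAddOrder_of_not_isSquare_kummerElt`, row
`KummerRankCertificate` + `_holds` (A+B concat check by -desc: rc 0 · 0 warn · 0 sorry, axioms trio).  Docstrings added where missing; REF1/REF2 slots in the
H″ docstring.  Row V′ (p623106/p623562) is the instance `W = E′_f`, `P = (0,c)` of H‴.  Builder `tools/mk_desc22kummer.py`.  No `sorry`, no `instance`, no
`notation`, no Literature fact.  PARTITION: none; beyond-print theorem: no (KNOWN support rows, kernel).

Planner's docstring (verbatim, -desc g14 `KummerHomRank.lean`):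
# DESC-§22-H″/H‴ — the Kummer map is a homomorphism mod squares; rank certificate (cell bsd-f1-sign2, -desc g14)

PART B of `KummerGeneral` (part A = Cassels' halving lemma, rows H′; this file needs part A's module — the import
line above uses the name SUGGESTED to -ty (`…ProofsKummer`); adjust it to the landed name).  Checked as the
concatenation `KummerGeneral-v3-concat.lean` (479 lines, rc 0 / 0 warnings / 0 sorries, axioms
{propext, Classical.choice, Quot.sound}).

* `kummerElt W P` (`κ(0) = 1`, `κ(x,y) = 4x − θ_W`), `isSquare_kummer_chord` (chord identity),
  `isSquare_kummerElt_mul_mul_add` (**H″**: `κ(P)κ(Q)κ(P+Q) ∈ L²` for all `P, Q`), `halves_iff_isSquare_kummerElt`,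
  `KummerMapHomomorphism` + `_holds`;
* `not_equation_zero_of_irreducible`, `eq_zero_of_two_nsmul_eq_zero_of_irreducible`, `…two_pow…`,
  `exists_halves_of_isOfFinAddOrder`, `not_isOfFinAddOrder_of_not_isSquare_kummerElt` (**H‴**: `c_W` irreducible,
  `κ(P) ∉ L² ⇒ P` of infinite order), `KummerRankCertificate` + `_holds`.
-/

noncomputable section

open scoped Classical

open WeierstrassCurve Polynomial

namespace Summit.BirchSwinnertonDyer.Rank1Residual.F1Sign2.Kummer
/-! ## The Kummer map is a homomorphism modulo squares

For `P ∈ W(ℚ)` put `κ(P) := 4x_P − θ ∈ L = ℚ[T]/(c_W)` (`κ(0) := 1`).  CHORD IDENTITY: for affine `P, Q` with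
`x_P ≠ x_Q`, `κ(P) κ(Q) κ(P+Q) = (2λ(θ − 4x_P) + 8y_P)²` with `λ` the chord slope (the line `y = λ(x − x_P) + y_P`
meets the cubic in `P, Q, −(P+Q)`; evaluate `g(x) − (λ(x−x_P)+y_P)² = (x−x_P)(x−x_Q)(x−x_{P+Q})` at `x = θ/4`).
Together with the tangent case (`isSquare_of_halves`) and the trivial cases this gives, uniformly in `P, Q`:
`κ(P) κ(Q) κ(P+Q) ∈ L^{×2} ∪ {0}·…` — precisely `IsSquare (κ P * κ Q * κ (P+Q))` — i.e. `κ : W(ℚ) → L^×/L^{×2}` is a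
group homomorphism, and by Cassels' lemma its kernel is exactly `2W(ℚ)`. -/

/-- CHORD IDENTITY: `(4x₁ − θ)(4x₂ − θ)(4x₃ − θ)` is a square in `L`, where `x₃ = x(P + Q)`, `x₁ ≠ x₂`. -/
theorem isSquare_kummer_chord (W : WeierstrassCurve ℚ) (h1 : W.a₁ = 0) (h3 : W.a₃ = 0) {x₁ y₁ x₂ y₂ : ℚ}
    (hx : x₁ ≠ x₂) (hP : W.toAffine.Equation x₁ y₁) (hQ : W.toAffine.Equation x₂ y₂) :
    IsSquare ((algebraMap ℚ (twoDivisionAlgebra W) (4 * x₁) - twoDivisionRoot W) *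
      (algebraMap ℚ (twoDivisionAlgebra W) (4 * x₂) - twoDivisionRoot W) *
      (algebraMap ℚ (twoDivisionAlgebra W) (4 * W.toAffine.addX x₁ x₂ (W.toAffine.slope x₁ x₂ y₁ y₂)) - twoDivisionRoot W)) := by
  rw [WeierstrassCurve.Affine.slope_of_X_ne hx]
  have heP := equation_of_a₁_a₃ W h1 h3 hP
  have heQ := equation_of_a₁_a₃ W h1 h3 hQ
  have hF := root_relation_of_a₁_a₃ W h1 h3
  have hx' : (x₁ - x₂) ≠ 0 := sub_ne_zero.mpr hx
  have hI0 := congrArg (algebraMap ℚ (twoDivisionAlgebra W)) (mul_inv_cancel₀ hx')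
  have hL0 : (y₁ - y₂) / (x₁ - x₂) * (x₁ - x₂) = y₁ - y₂ := div_mul_cancel₀ _ hx'
  have hL := congrArg (algebraMap ℚ (twoDivisionAlgebra W)) hL0
  have heP' := congrArg (algebraMap ℚ (twoDivisionAlgebra W)) heP
  have heQ' := congrArg (algebraMap ℚ (twoDivisionAlgebra W)) heQ
  simp only [WeierstrassCurve.Affine.addX, h1, zero_mul, add_zero, map_mul, map_sub, map_add, map_pow, map_one,
    map_ofNat] at hI0 hL heP' heQ' ⊢
  refine ⟨2 * algebraMap ℚ (twoDivisionAlgebra W) ((y₁ - y₂) / (x₁ - x₂)) *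
      (twoDivisionRoot W - 4 * algebraMap ℚ (twoDivisionAlgebra W) x₁) + 8 * algebraMap ℚ (twoDivisionAlgebra W) y₁, ?_⟩
  generalize twoDivisionRoot W = t at hF ⊢
  generalize algebraMap ℚ (twoDivisionAlgebra W) ((y₁ - y₂) / (x₁ - x₂)) = Lam at hL ⊢
  generalize algebraMap ℚ (twoDivisionAlgebra W) (x₁ - x₂)⁻¹ = I at hI0 ⊢
  generalize algebraMap ℚ (twoDivisionAlgebra W) x₁ = X1 at heP' hL hI0 ⊢
  generalize algebraMap ℚ (twoDivisionAlgebra W) x₂ = X2 at heQ' hL hI0 ⊢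
  generalize algebraMap ℚ (twoDivisionAlgebra W) y₁ = Y1 at heP' hL ⊢
  generalize algebraMap ℚ (twoDivisionAlgebra W) y₂ = Y2 at heQ' hL ⊢
  generalize algebraMap ℚ (twoDivisionAlgebra W) W.a₂ = A2 at hF heP' heQ' ⊢
  generalize algebraMap ℚ (twoDivisionAlgebra W) W.a₄ = A4 at hF heP' heQ' ⊢
  generalize algebraMap ℚ (twoDivisionAlgebra W) W.a₆ = A6 at hF heP' heQ' ⊢
  linear_combination (-1) * hF +
    (-((4 * X1 - t) * (4 * X2 - t) * (4 * (Lam ^ 2 - A2 - X1 - X2) - t) - (2 * Lam * (t - 4 * X1) + 8 * Y1) ^ 2 +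
      (t ^ 3 + 4 * A2 * t ^ 2 + 16 * A4 * t + 64 * A6))) * hI0 +
    (16 * I * (4 * X2 - t)) * heP' + (16 * I * (t - 4 * X1)) * heQ' +
    (-(16 * I * (t - 4 * X1) * (Y2 + Lam * (X2 - X1) + Y1))) * hL

/-- The Kummer element of a rational point: `κ(0) = 1`, `κ((x, y)) = 4x − θ`. -/
def kummerElt (W : WeierstrassCurve ℚ) : W.toAffine.Point → twoDivisionAlgebra W
  | .zero => 1
  | .some x _ _ => algebraMap ℚ (twoDivisionAlgebra W) (4 * x) - twoDivisionRoot W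

/-- `κ(0) = 1`. -/
@[simp] lemma kummerElt_zero (W : WeierstrassCurve ℚ) : kummerElt W 0 = 1 := rfl

/-- `κ((x,y)) = 4x − θ`. -/
@[simp] lemma kummerElt_some (W : WeierstrassCurve ℚ) {x y : ℚ} (h : W.toAffine.Nonsingular x y) :
    kummerElt W (WeierstrassCurve.Affine.Point.some x y h) = algebraMap ℚ (twoDivisionAlgebra W) (4 * x) - twoDivisionRoot W := rfl

/-- `κ(−P) = κ(P)`. -/
lemma kummerElt_neg (W : WeierstrassCurve ℚ) (P : W.toAffine.Point) : kummerElt W (-P) = kummerElt W P := by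
  rcases P with _ | ⟨x, y, h⟩
  · rfl
  · rfl

/-- **THE KUMMER MAP IS A HOMOMORPHISM MODULO SQUARES** (uniform in `P, Q`, all cases: `0`, opposite, tangent, chord):
`κ(P) · κ(Q) · κ(P + Q)` is a square in `L = ℚ[T]/(c_W)`. -/
theorem isSquare_kummerElt_mul_mul_add (W : WeierstrassCurve ℚ) (h1 : W.a₁ = 0) (h3 : W.a₃ = 0)
    (P Q : W.toAffine.Point) : IsSquare (kummerElt W P * kummerElt W Q * kummerElt W (P + Q)) := by
  rcases P with _ | ⟨x₁, y₁, hP⟩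
  · simp only [← WeierstrassCurve.Affine.Point.zero_def, kummerElt_zero, one_mul, zero_add]
    exact ⟨kummerElt W Q, rfl⟩
  rcases Q with _ | ⟨x₂, y₂, hQ⟩
  · simp only [← WeierstrassCurve.Affine.Point.zero_def, kummerElt_zero, mul_one, add_zero]
    exact ⟨kummerElt W (WeierstrassCurve.Affine.Point.some x₁ y₁ hP), rfl⟩
  by_cases hx : x₁ = x₂
  · subst hx
    by_cases hy : y₁ = W.toAffine.negY x₁ y₂
    · rw [WeierstrassCurve.Affine.Point.add_of_Y_eq rfl hy]
      simp only [kummerElt_zero, kummerElt_some, mul_one]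
      exact ⟨algebraMap ℚ (twoDivisionAlgebra W) (4 * x₁) - twoDivisionRoot W, rfl⟩
    · -- tangent case: `y₂ = y₁` (same `x`, `y₁ ≠ −y₂`), so `Q = P` and `κ(P)² κ(2P)` is a square by the halving lemma.
      have hy21 : y₂ = y₁ := by
        have e1 := equation_of_a₁_a₃ W h1 h3 hP.1
        have e2 := equation_of_a₁_a₃ W h1 h3 hQ.1
        rw [negY_of_a₁_a₃ W h1 h3] at hy
        have hsq : (y₂ - y₁) * (y₂ + y₁) = 0 := by linear_combination e2 - e1
        rcases mul_eq_zero.mp hsq with h0 | h0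
        · linarith
        · exact absurd (by linarith : y₁ = -y₂) hy
      subst hy21
      rcases hR : WeierstrassCurve.Affine.Point.some x₁ y₂ hP + WeierstrassCurve.Affine.Point.some x₁ y₂ hQ with _ | ⟨x₃, y₃, h₃⟩
      · simp only [← WeierstrassCurve.Affine.Point.zero_def, kummerElt_zero, kummerElt_some, mul_one]
        exact ⟨algebraMap ℚ (twoDivisionAlgebra W) (4 * x₁) - twoDivisionRoot W, rfl⟩
      · obtain ⟨r, hr⟩ := isSquare_of_halves W h1 h3 h₃ (WeierstrassCurve.Affine.Point.some x₁ y₂ hP) hR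
        simp only [kummerElt_some]
        exact ⟨(algebraMap ℚ (twoDivisionAlgebra W) (4 * x₁) - twoDivisionRoot W) * r, by rw [hr]; ring⟩
  · rw [WeierstrassCurve.Affine.Point.add_of_X_ne hx]
    simp only [kummerElt_some]
    exact isSquare_kummer_chord W h1 h3 hx hP.1 hQ.1

/-- Point-level CASSELS' LEMMA (uniform, `0` included): `P ∈ 2W(ℚ) ⟺ κ(P) ∈ L²`. -/
theorem halves_iff_isSquare_kummerElt (W : WeierstrassCurve ℚ) (h1 : W.a₁ = 0) (h3 : W.a₃ = 0) (P : W.toAffine.Point) :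
    (∃ Q : W.toAffine.Point, Q + Q = P) ↔ IsSquare (kummerElt W P) := by
  rcases P with _ | ⟨x, y, h⟩
  · simp only [← WeierstrassCurve.Affine.Point.zero_def, kummerElt_zero]
    exact ⟨fun _ => ⟨1, (mul_one 1).symm⟩, fun _ => ⟨0, add_zero 0⟩⟩
  · simp only [kummerElt_some]
    exact halves_iff_isSquare W h1 h3 h

/-- DESC-§22-H″ (support, KNOWN in print: the Kummer / Cassels `x − θ` map is a homomorphism `W(ℚ) → L^×/L^{×2}`):
for every `W : y² = x³ + a₂x² + a₄x + a₆` over `ℚ` and all `P, Q ∈ W(ℚ)`, `κ(P) κ(Q) κ(P+Q) ∈ L²`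
(`κ(0) = 1`, `κ(x,y) = 4x − θ_W`).  With H′ (`KummerHalvingCriterion`, point-level form `halves_iff_isSquare_kummerElt`):
`ker κ = 2W(ℚ)`, i.e. `κ̄ : W(ℚ)/2W(ℚ) ↪ L^×/L^{×2}` — the 2-descent (Kummer) embedding, kernel-certified for every such `W`.
PROVED (`kummerMapHomomorphism_holds`).
REF1-AUDIT §94 (g9, D-desc-ref1-24 extension, 2026-08-28T10:59:52Z): H″ SURVIVES, PROVED (kernel, trio), CLEARED — Cassels §15 Lemma 1 in the unpatched form `IsSquare (κP·κQ·κ(P+Q))`, uniform in all cases, NO irreducibility needed; rider r2: the gloss «`κ̄ : W(ℚ)/2W(ℚ) ↪ L^×/L^{×2}`» is literal only for irreducible `c_W` (at a rational 2-torsion point the unpatched `κ` is a zero-divisor and Cassels' patch (iii), LMSST p. 42 L45, is needed — e2/e3); H‴ SURVIVES, PROVED, CLEARED, `Irreducible (twoDivisionUCubic W)` NECESSARY as typed (r3; e1: `y² = x³ − x`); landing certificate p625143 ← `KummerHomRank.lean` bc2f4f6d031ee931 16 SAME / 0 DIFF; r5: p625143's six deferrals were the farm's part-A olean lag (accepted 10:30:28Z,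 no resubmission).
REF2-PLACEMENT v24 §1 (45974357b6e499b5, 10:27:23Z) + P.S. (10:28:24Z): KNOWN — Cassels 1991 LMSST §15 Lemma 1 (κ multiplicative modulo squares) + Lemma 2 (kernel = 2E(ℚ)) [p0042 L45 – p0043 L49]; Kummer map homomorphism = Silverman AEC X.1.4; formalisation; beyond-print no; PARTITION none.
[cite: Cassels1991, §15 Lemma 2] [cite: SilvermanAEC2009, Prop. X.1.4] -/
def KummerMapHomomorphism : Prop :=
  ∀ (W : WeierstrassCurve ℚ), W.a₁ = 0 → W.a₃ = 0 → ∀ (P Q : W.toAffine.Point),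
    IsSquare (kummerElt W P * kummerElt W Q * kummerElt W (P + Q))

/-- **Row DESC-§22-H″ HOLDS** (kernel). -/
theorem kummerMapHomomorphism_holds : KummerMapHomomorphism :=
  fun W h1 h3 P Q => isSquare_kummerElt_mul_mul_add W h1 h3 P Q

/-! ## Rank certificate: a non-square Kummer value forces infinite order

If the 2-division cubic `c_W` is irreducible over `ℚ` then `W(ℚ)[2] = 0`, every torsion point has odd order and hence
lies in `2W(ℚ)`, so its Kummer value is a square (H′).  Contrapositive: **`κ(P) ∉ L² ⇒ P has infinite order`** — a
rank-`≥ 1` certificate from ONE non-square value, for every `y² = x³ + a₂x² + a₄x + a₆` (row V′ is its instance at the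
marked point of the glued partner). -/

/-- No rational point with `y = 0` when `c_W` is irreducible (`a₁ = a₃ = 0`). -/
lemma not_equation_zero_of_irreducible (W : WeierstrassCurve ℚ) (h1 : W.a₁ = 0) (h3 : W.a₃ = 0)
    (hirr : Irreducible (twoDivisionUCubic W)) {x : ℚ} (h : W.toAffine.Equation x 0) : False := by
  have heq := equation_of_a₁_a₃ W h1 h3 h
  have hroot : IsRoot (twoDivisionUCubic W) (4 * x) := by
    simp only [IsRoot, twoDivisionUCubic, eval_add, eval_mul, eval_pow, eval_X, eval_C, b₂_of_a₁ W h1,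
      b₄_of_a₁_a₃ W h1 h3, b₆_of_a₃ W h3]
    linear_combination (-64) * heq
  have hd1 := degree_eq_one_of_irreducible_of_root hirr hroot
  have hd3 : (twoDivisionUCubic W).degree = 3 := by
    unfold twoDivisionUCubic; compute_degree!
  rw [hd3] at hd1
  exact absurd hd1 (by decide)

/-- `W(ℚ)[2] = 0` when `c_W` is irreducible. -/
lemma eq_zero_of_two_nsmul_eq_zero_of_irreducible (W : WeierstrassCurve ℚ) (h1 : W.a₁ = 0) (h3 : W.a₃ = 0)
    (hirr : Irreducible (twoDivisionUCubic W)) (S : W.toAffine.Point) (h2 : S + S = 0) : S = 0 := by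
  rcases S with _ | ⟨x, y, hS⟩
  · rfl
  · by_cases hy : y = W.toAffine.negY x y
    · have hy0 : y = 0 := by rw [negY_of_a₁_a₃ W h1 h3] at hy; linarith
      subst hy0
      exact (not_equation_zero_of_irreducible W h1 h3 hirr hS.1).elim
    · rw [WeierstrassCurve.Affine.Point.add_self_of_Y_ne hy] at h2
      exact absurd h2 (WeierstrassCurve.Affine.Point.some_ne_zero _)

/-- `2^k • P = 0 ⇒ P = 0` when `c_W` is irreducible (`W(ℚ)[2^∞] = 0`). -/
lemma eq_zero_of_two_pow_nsmul_eq_zero_of_irreducible (W : WeierstrassCurve ℚ) (h1 : W.a₁ = 0) (h3 : W.a₃ = 0)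
    (hirr : Irreducible (twoDivisionUCubic W)) (k : ℕ) : ∀ S : W.toAffine.Point, (2 ^ k) • S = 0 → S = 0 := by
  induction k with
  | zero => intro S h; simpa using h
  | succ k ih =>
      intro S h
      have h' : (2 ^ k) • (S + S) = 0 := by
        rw [← two_nsmul, ← mul_nsmul, ← pow_succ']; exact h
      exact eq_zero_of_two_nsmul_eq_zero_of_irreducible W h1 h3 hirr S (ih _ h')

/-- Torsion points are divisible by `2` when `c_W` is irreducible (their order is odd). -/
theorem exists_halves_of_isOfFinAddOrder (W : WeierstrassCurve ℚ) (h1 : W.a₁ = 0) (h3 : W.a₃ = 0)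
    (hirr : Irreducible (twoDivisionUCubic W)) (P : W.toAffine.Point) (hfin : IsOfFinAddOrder P) :
    ∃ Q : W.toAffine.Point, Q + Q = P := by
  obtain ⟨n, hn, hnP⟩ := (isOfFinAddOrder_iff_nsmul_eq_zero).mp hfin
  obtain ⟨k, m, hm, rfl⟩ := Nat.exists_eq_two_pow_mul_odd hn.ne'
  have e1 : (2 ^ k) • (m • P) = 0 := by
    rw [← mul_nsmul, Nat.mul_comm]; exact hnP
  have e2 : m • P = 0 := eq_zero_of_two_pow_nsmul_eq_zero_of_irreducible W h1 h3 hirr k _ e1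
  obtain ⟨j, rfl⟩ := hm
  refine ⟨-(j • P), ?_⟩
  have e3 : (2 * j) • P + P = 0 := by rw [← succ_nsmul]; exact e2
  rw [mul_nsmul', two_nsmul] at e3
  rw [← neg_add]
  exact (eq_neg_of_add_eq_zero_right e3).symm

/-- **RANK CERTIFICATE**: `c_W` irreducible and `κ(P) ∉ L²` ⇒ `P` has infinite order (so `rank W(ℚ) ≥ 1`). -/
theorem not_isOfFinAddOrder_of_not_isSquare_kummerElt (W : WeierstrassCurve ℚ) (h1 : W.a₁ = 0) (h3 : W.a₃ = 0)
    (hirr : Irreducible (twoDivisionUCubic W)) (P : W.toAffine.Point) (hP : ¬ IsSquare (kummerElt W P)) :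
    ¬ IsOfFinAddOrder P :=
  fun hfin => hP ((halves_iff_isSquare_kummerElt W h1 h3 P).mp (exists_halves_of_isOfFinAddOrder W h1 h3 hirr P hfin))

/-- DESC-§22-H‴ (support): for every `W : y² = x³ + a₂x² + a₄x + a₆` over `ℚ` with irreducible 2-division cubic and every
`P ∈ W(ℚ)`: `κ(P) = 4x_P − θ_W ∉ L^{2} ⇒ P` has infinite order.  (Row V′ = the instance `W = E′_f`, `P = (0,c)`, where
`κ(P) = −θ′` and `−θ′ ∈ L′² ⟺ u ∈ L²` by the glued-pair identity.)  PROVED (`kummerRankCertificate_holds`); census instance table = -desc T2 column —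
kit j305814 T4-EXACT run 4 483/4 483 (UPDATE 9, 2026-08-28T11:38:02Z; REF1 §102 reproduced; supersedes the j304550 partial 2 177/2 177).  REF1 §94: SURVIVES, PROVED, CLEARED; `Irreducible` is NECESSARY as typed (e1: on `y² = x³ − x` the point `(−1,0)` has finite order and
non-square (zero-divisor) `κ`).  REF2 v24 §1: KNOWN (Cassels 1991 §15 Lemmas 1–2); formalisation; beyond-print no. -/
def KummerRankCertificate : Prop :=
  ∀ (W : WeierstrassCurve ℚ), W.a₁ = 0 → W.a₃ = 0 → Irreducible (twoDivisionUCubic W) →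
    ∀ (P : W.toAffine.Point), ¬ IsSquare (kummerElt W P) → ¬ IsOfFinAddOrder P

/-- **Row DESC-§22-H‴ HOLDS** (kernel). -/
theorem kummerRankCertificate_holds : KummerRankCertificate :=
  fun W h1 h3 hirr P hP => not_isOfFinAddOrder_of_not_isSquare_kummerElt W h1 h3 hirr P hP

end Summit.BirchSwinnertonDyer.Rank1Residual.F1Sign2.Kummer

end
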